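import Literature.Topology.FourManifolds.LefschetzBaseCircleMaps
import HarnessLib

/-!
# The circle-valued maps of all clopen subsets of `U ∩ V` on the Lefschetz base

Topic `Literature/Topology/FourManifolds`; sequel of `LefschetzBaseCircleMaps.lean`, which built,
for the clopen sets `C_j ⊆ U ∩ V` of the Milnor cover `Base g = U ∪ V`, the circle-valued maps
`phi g j : Base g → ℝ/ℤ` (`FU = ρ_V χ` on `U`, `FV = (ρ_V − 1) χ` on `V`, `χ = 1_{C_j}`).  Here the
same construction is run for an ARBITRARY clopen `C ⊆ U ∩ V` (`phiOf C hC`), with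
`phi g j = phiOf (Cset g j) _`, and its algebra is recorded:

* `phiOf_union` — additivity over disjoint clopen sets (pointwise in `ℝ/ℤ`);
* `phiOf_univ` — for `C = U ∩ V` the map is `ρ_V mod 1`, which has the GLOBAL real lift `ρ_V`;
* `phiOf_comp_eq` — equivariance: for a continuous self-map `T` of the base preserving
  `Re x^{2g+1}` (hence `U`, `V` and `ρ_V`), `phiOf C ∘ T = phiOf (T⁻¹ C)`.

These are the inputs of the symmetry argument showing that the `phi g j` lift near the binding
of the base open book (`LefschetzBaseBindingLift.lean`), the last base-side input of the
Legendrian-realisation step of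
`Literature.Geometry.Symplectic.palf_stein_supportedByBoundaryOpenBook`.  Bott–Tu 1982, §2
(Mayer–Vietoris coboundary of a locally constant function on `U ∩ V` as a map to `K(ℤ,1) = S¹`);
everything is proved, no named facts.

## References
* R. Bott, L. W. Tu, *Differential Forms in Algebraic Topology* (1982), §2 Prop. 2.3, Ex. 2.5. [BottTu1982Forms]
* J. Milnor, *Singular points of complex hypersurfaces* (1968), §9, Lemma 9.2. [Milnor1968]
-/

noncomputable section

open scoped Manifold ContDiff Topology
open Set Function Filter
open Literature.AlgebraicTopology.SingularHomology

namespace Literature.Topology.FourManifolds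

namespace LefschetzBase

variable {g : ℕ}

/-! ### The indicator of a clopen subset of `U ∩ V` -/

/-- **The indicator `chiOf C` of `C ⊆ U ∩ V`**, extended by `0` off `U ∩ V`. [cite: BottTu1982Forms, §2 Prop. 2.3] -/
def chiOf (C : Set ↥(coverU g ∩ coverV g)) (p : Base g) : ℝ := by
  classical
  exact if h : p ∈ coverU g ∩ coverV g then C.indicator (fun _ => (1 : ℝ)) ⟨p, h⟩ else 0

variable {C C' : Set ↥(coverU g ∩ coverV g)}

/-- On `U ∩ V`, `chiOf C` is the indicator of `C`. [folklore] -/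
theorem chiOf_of_mem {p : Base g} (h : p ∈ coverU g ∩ coverV g) :
    chiOf C p = C.indicator (fun _ => (1 : ℝ)) ⟨p, h⟩ := by
  classical
  exact dif_pos h

/-- `chiOf C = 1` at the points of `C`. [folklore] -/
theorem chiOf_eq_one {p : Base g} (h : p ∈ coverU g ∩ coverV g) (hC : ⟨p, h⟩ ∈ C) : chiOf C p = 1 := by
  rw [chiOf_of_mem h, indicator_of_mem hC]

/-- `chiOf C = 0` at the points of `(U ∩ V) ∖ C`. [folklore] -/
theorem chiOf_eq_zero {p : Base g} (h : p ∈ coverU g ∩ coverV g) (hC : ⟨p, h⟩ ∉ C) : chiOf C p = 0 := by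
  rw [chiOf_of_mem h, indicator_of_notMem hC]

/-- `chiOf C = 0` off `U ∩ V`. [folklore] -/
theorem chiOf_of_not_mem {p : Base g} (h : p ∉ coverU g ∩ coverV g) : chiOf C p = 0 := by
  classical
  exact dif_neg h

/-- `chiOf` takes the values `0` and `1` only. [folklore] -/
theorem chiOf_eq_zero_or_one (C : Set ↥(coverU g ∩ coverV g)) (p : Base g) :
    chiOf C p = 0 ∨ chiOf C p = 1 := by
  by_cases h : p ∈ coverU g ∩ coverV g
  · by_cases hC : (⟨p, h⟩ : ↥(coverU g ∩ coverV g)) ∈ C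
    · exact Or.inr (chiOf_eq_one h hC)
    · exact Or.inl (chiOf_eq_zero h hC)
  · exact Or.inl (chiOf_of_not_mem h)

/-- `chiOf` is an integer. [folklore] -/
theorem exists_int_chiOf (C : Set ↥(coverU g ∩ coverV g)) (p : Base g) : ∃ k : ℤ, chiOf C p = k := by
  rcases chiOf_eq_zero_or_one C p with h | h
  · exact ⟨0, by rw [h, Int.cast_zero]⟩
  · exact ⟨1, by rw [h, Int.cast_one]⟩

/-- **`chiOf C` is locally constant on `U ∩ V`** when `C` is clopen there. [folklore] -/
theorem eventually_chiOf_eq (hC : IsClopen C) {p : Base g} (h : p ∈ coverU g ∩ coverV g) :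
    chiOf C =ᶠ[𝓝 p] fun _ => chiOf C p := by
  have hUV : IsOpen (coverU g ∩ coverV g) := (isOpen_coverU g).inter (isOpen_coverV g)
  by_cases hpC : (⟨p, h⟩ : ↥(coverU g ∩ coverV g)) ∈ C
  · obtain ⟨O, hO, hOC⟩ := isOpen_induced_iff.1 hC.isOpen
    have hpO : p ∈ O := by
      have : (⟨p, h⟩ : ↥(coverU g ∩ coverV g)) ∈ Subtype.val ⁻¹' O := by rw [hOC]; exact hpC
      exact this
    filter_upwards [hO.mem_nhds hpO, hUV.mem_nhds h] with q hqO hq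
    have hqC : (⟨q, hq⟩ : ↥(coverU g ∩ coverV g)) ∈ C := by
      rw [← hOC]; exact hqO
    rw [chiOf_eq_one hq hqC, chiOf_eq_one h hpC]
  · obtain ⟨O, hO, hOC⟩ := isOpen_induced_iff.1 hC.compl.isOpen
    have hpO : p ∈ O := by
      have : (⟨p, h⟩ : ↥(coverU g ∩ coverV g)) ∈ Subtype.val ⁻¹' O := by rw [hOC]; exact hpC
      exact this
    filter_upwards [hO.mem_nhds hpO, hUV.mem_nhds h] with q hqO hq
    have hqC : (⟨q, hq⟩ : ↥(coverU g ∩ coverV g)) ∉ C := by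
      show (⟨q, hq⟩ : ↥(coverU g ∩ coverV g)) ∈ Cᶜ
      rw [← hOC]; exact hqO
    rw [chiOf_eq_zero hq hqC, chiOf_eq_zero h hpC]

/-- `chiOf C` is smooth on `U ∩ V` (`C` clopen). [folklore] -/
theorem contMDiffAt_chiOf (hC : IsClopen C) {p : Base g} (h : p ∈ coverU g ∩ coverV g) :
    ContMDiffAt (𝓡∂ 4) 𝓘(ℝ, ℝ) ∞ (chiOf C) p :=
  contMDiffAt_const.congr_of_eventuallyEq (eventually_chiOf_eq hC h)

/-- `chiC g j` is the indicator of `C_j`. [folklore] -/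
theorem chiC_eq_chiOf (g j : ℕ) : chiC g j = chiOf (Cset g j) := by
  funext p
  by_cases h : p ∈ coverU g ∩ coverV g
  · rw [chiC_of_mem j h, chiOf_of_mem h]
  · rw [chiC_of_not_mem j h, chiOf_of_not_mem h]

/-! ### The real lifts and the circle map of a clopen set -/

/-- The lift on `U`: `ρ_V · χ_C`. [cite: BottTu1982Forms, §2 Prop. 2.3] -/
def FUOf (C : Set ↥(coverU g ∩ coverV g)) (p : Base g) : ℝ := rhoV p * chiOf C p

/-- The lift on `V`: `(ρ_V − 1) · χ_C`. [cite: BottTu1982Forms, §2 Prop. 2.3] -/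
def FVOf (C : Set ↥(coverU g ∩ coverV g)) (p : Base g) : ℝ := (rhoV p - 1) * chiOf C p

/-- `FUOf − FVOf = chiOf`. [folklore] -/
theorem FUOf_sub_FVOf (C : Set ↥(coverU g ∩ coverV g)) (p : Base g) : FUOf C p - FVOf C p = chiOf C p := by
  rw [FUOf, FVOf]; ring

/-- `FU g j = FUOf (Cset g j)`. [folklore] -/
theorem FU_eq_FUOf (g j : ℕ) : FU g j = FUOf (Cset g j) := by
  funext p; rw [FU, FUOf, chiC_eq_chiOf]

/-- `FV g j = FVOf (Cset g j)`. [folklore] -/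
theorem FV_eq_FVOf (g j : ℕ) : FV g j = FVOf (Cset g j) := by
  funext p; rw [FV, FVOf, chiC_eq_chiOf]

/-- `FUOf = 0` where `Re x^{2g+1} ≥ −0.27`. [folklore] -/
theorem FUOf_eq_zero_of_le {p : Base g} (hp : -(27 / 100 : ℝ) ≤ rePow p) : FUOf C p = 0 := by
  rw [FUOf, rhoV_eq_zero hp, zero_mul]

/-- `FVOf = 0` where `Re x^{2g+1} ≤ −0.35`. [folklore] -/
theorem FVOf_eq_zero_of_le {p : Base g} (hp : rePow p ≤ -(35 / 100 : ℝ)) : FVOf C p = 0 := by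
  rw [FVOf, rhoV_eq_one hp, sub_self, zero_mul]

/-- `FUOf C` is smooth on `U` (`C` clopen). [folklore] -/
theorem contMDiffAt_FUOf (hC : IsClopen C) {p : Base g} (hp : p ∈ coverU g) :
    ContMDiffAt (𝓡∂ 4) 𝓘(ℝ, ℝ) ∞ (FUOf C) p := by
  by_cases hre : -(27 / 100 : ℝ) < rePow p
  · have hev : FUOf C =ᶠ[𝓝 p] fun _ => (0 : ℝ) := by
      filter_upwards [(isOpen_lt continuous_const (continuous_rePow g)).mem_nhds hre] with q hq
      exact FUOf_eq_zero_of_le (le_of_lt hq)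
    exact contMDiffAt_const.congr_of_eventuallyEq hev
  · have hV : p ∈ coverV g := by
      rw [mem_coverV_iff]; push Not at hre; linarith
    exact (contMDiff_rhoV g p).mul (contMDiffAt_chiOf hC ⟨hp, hV⟩)

/-- `FVOf C` is smooth on `V` (`C` clopen). [folklore] -/
theorem contMDiffAt_FVOf (hC : IsClopen C) {p : Base g} (hp : p ∈ coverV g) :
    ContMDiffAt (𝓡∂ 4) 𝓘(ℝ, ℝ) ∞ (FVOf C) p := by
  by_cases hre : rePow p < -(35 / 100 : ℝ)
  · have hev : FVOf C =ᶠ[𝓝 p] fun _ => (0 : ℝ) := by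
      filter_upwards [(isOpen_lt (continuous_rePow g) continuous_const).mem_nhds hre] with q hq
      exact FVOf_eq_zero_of_le (le_of_lt hq)
    exact contMDiffAt_const.congr_of_eventuallyEq hev
  · have hU : p ∈ coverU g := by
      rw [mem_coverU_iff]; push Not at hre; linarith
    exact ((contMDiff_rhoV g p).sub contMDiffAt_const).mul (contMDiffAt_chiOf hC ⟨hU, hp⟩)

/-- `FUOf mod 1 = FVOf mod 1` everywhere. [folklore] -/
theorem coe_FUOf_eq_coe_FVOf (C : Set ↥(coverU g ∩ coverV g)) (p : Base g) :
    ((FUOf C p : ℝ) : UnitAddCircle) = ((FVOf C p : ℝ) : UnitAddCircle) := by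
  obtain ⟨k, hk⟩ := exists_int_chiOf C p
  have e : FUOf C p = FVOf C p + k := by rw [← hk, ← FUOf_sub_FVOf]; ring
  rw [e, coe_add_intCast]

/-- The underlying function: `FUOf mod 1` on `U`, `FVOf mod 1` elsewhere. [cite: BottTu1982Forms, §2 Prop. 2.3] -/
def phiOfFun (C : Set ↥(coverU g ∩ coverV g)) (p : Base g) : UnitAddCircle := by
  classical
  exact if p ∈ coverU g then ((FUOf C p : ℝ) : UnitAddCircle) else ((FVOf C p : ℝ) : UnitAddCircle)

/-- `phiOfFun = FUOf mod 1` on `U`. [folklore] -/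
theorem phiOfFun_eq_coe_FUOf {p : Base g} (hp : p ∈ coverU g) :
    phiOfFun C p = ((FUOf C p : ℝ) : UnitAddCircle) := by
  classical
  exact if_pos hp

/-- `phiOfFun = FVOf mod 1` everywhere. [folklore] -/
theorem phiOfFun_eq_coe_FVOf (C : Set ↥(coverU g ∩ coverV g)) (p : Base g) :
    phiOfFun C p = ((FVOf C p : ℝ) : UnitAddCircle) := by
  classical
  by_cases hp : p ∈ coverU g
  · rw [phiOfFun_eq_coe_FUOf hp, coe_FUOf_eq_coe_FVOf]
  · exact if_neg hp

/-- `phiOfFun C` is continuous (`C` clopen). [cite: BottTu1982Forms, §2 Prop. 2.3] -/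
theorem continuous_phiOfFun (hC : IsClopen C) : Continuous (phiOfFun C) := by
  rw [continuous_iff_continuousAt]
  intro p
  have hcov : p ∈ coverU g ∪ coverV g := by rw [coverU_union_coverV]; exact mem_univ p
  rcases hcov with hU | hV
  · have hc : ContinuousAt (fun q => ((FUOf C q : ℝ) : UnitAddCircle)) p :=
      (continuous_quotient_mk'.continuousAt).comp ((contMDiffAt_FUOf hC hU).continuousAt)
    refine hc.congr_of_eventuallyEq ?_
    filter_upwards [(isOpen_coverU g).mem_nhds hU] with q hq
    exact phiOfFun_eq_coe_FUOf hq
  · have hc : ContinuousAt (fun q => ((FVOf C q : ℝ) : UnitAddCircle)) p :=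
      (continuous_quotient_mk'.continuousAt).comp ((contMDiffAt_FVOf hC hV).continuousAt)
    exact hc.congr_of_eventuallyEq (Eventually.of_forall fun q => phiOfFun_eq_coe_FVOf C q)

/-- **The circle-valued map `phiOf C hC : Base g → ℝ/ℤ` of a clopen `C ⊆ U ∩ V`.**
[cite: BottTu1982Forms, §2 Prop. 2.3] -/
def phiOf (C : Set ↥(coverU g ∩ coverV g)) (hC : IsClopen C) : C(Base g, UnitAddCircle) :=
  ⟨phiOfFun C, continuous_phiOfFun hC⟩

/-- `phiOf C = FUOf C mod 1` on `U`. [folklore] -/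
theorem phiOf_eq_coe_FUOf (hC : IsClopen C) {p : Base g} (hp : p ∈ coverU g) :
    phiOf C hC p = ((FUOf C p : ℝ) : UnitAddCircle) :=
  phiOfFun_eq_coe_FUOf hp

/-- `phiOf C = FVOf C mod 1` everywhere. [folklore] -/
theorem phiOf_eq_coe_FVOf (hC : IsClopen C) (p : Base g) :
    phiOf C hC p = ((FVOf C p : ℝ) : UnitAddCircle) :=
  phiOfFun_eq_coe_FVOf C p

/-- **`phi g j = phiOf (Cset g j)`.** [folklore] -/
theorem phi_eq_phiOf (g j : ℕ) : phi g j = phiOf (Cset g j) (isClopen_Cset j) := by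
  ext p
  show phi g j p = phiOf (Cset g j) (isClopen_Cset j) p
  have hcov : p ∈ coverU g ∪ coverV g := by rw [coverU_union_coverV]; exact mem_univ p
  rcases hcov with hU | hV
  · rw [phi_eq_coe_FU j hU, phiOf_eq_coe_FUOf _ hU, FU_eq_FUOf]
  · rw [phi_eq_coe_FV j hV, phiOf_eq_coe_FVOf, FV_eq_FVOf]

/-- **`phiOf C` has smooth local real lifts** (`FUOf` on `U`, `FVOf` on `V`). [cite: BottTu1982Forms, §2 Prop. 2.3] -/
theorem exists_smooth_lift_phiOf (hC : IsClopen C) (p : Base g) :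
    ∃ (W : Set (Base g)) (F : Base g → ℝ), IsOpen W ∧ p ∈ W ∧
      (∀ q ∈ W, ContMDiffAt (𝓡∂ 4) 𝓘(ℝ, ℝ) ∞ F q) ∧ ∀ q ∈ W, phiOf C hC q = ((F q : ℝ) : UnitAddCircle) := by
  have hcov : p ∈ coverU g ∪ coverV g := by rw [coverU_union_coverV]; exact mem_univ p
  rcases hcov with hU | hV
  · exact ⟨coverU g, FUOf C, isOpen_coverU g, hU, fun q hq => contMDiffAt_FUOf hC hq,
      fun q hq => phiOf_eq_coe_FUOf hC hq⟩
  · exact ⟨coverV g, FVOf C, isOpen_coverV g, hV, fun q hq => contMDiffAt_FVOf hC hq,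
      fun q _ => phiOf_eq_coe_FVOf hC q⟩

/-! ### Additivity and the trivial case `C = U ∩ V` -/

/-- `χ_{C ∪ C'} = χ_C + χ_{C'}` for disjoint sets. [folklore] -/
theorem chiOf_union (hd : Disjoint C C') (p : Base g) : chiOf (C ∪ C') p = chiOf C p + chiOf C' p := by
  by_cases h : p ∈ coverU g ∩ coverV g
  · rw [chiOf_of_mem h, chiOf_of_mem h, chiOf_of_mem h, indicator_union_of_disjoint hd]
  · rw [chiOf_of_not_mem h, chiOf_of_not_mem h, chiOf_of_not_mem h, add_zero]

/-- `FVOf (C ∪ C') = FVOf C + FVOf C'` for disjoint sets. [folklore] -/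
theorem FVOf_union (hd : Disjoint C C') (p : Base g) : FVOf (C ∪ C') p = FVOf C p + FVOf C' p := by
  rw [FVOf, FVOf, FVOf, chiOf_union hd]; ring

/-- **Additivity**: `phiOf (C ∪ C') = phiOf C + phiOf C'` (pointwise in `ℝ/ℤ`) for disjoint
clopen sets. [cite: BottTu1982Forms, §2 Prop. 2.3] -/
theorem phiOf_union (hC : IsClopen C) (hC' : IsClopen C') (hd : Disjoint C C') (p : Base g) :
    phiOf (C ∪ C') (hC.union hC') p = phiOf C hC p + phiOf C' hC' p := by
  rw [phiOf_eq_coe_FVOf, phiOf_eq_coe_FVOf, phiOf_eq_coe_FVOf, FVOf_union hd, QuotientAddGroup.mk_add]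

/-- **Additivity over finite disjoint unions.** [cite: BottTu1982Forms, §2 Prop. 2.3] -/
theorem phiOf_iUnion_finset {ι : Type*} (s : Finset ι) (D : ι → Set ↥(coverU g ∩ coverV g))
    (hD : ∀ i, IsClopen (D i)) (hd : Pairwise fun i j => Disjoint (D i) (D j))
    (hU : IsClopen (⋃ i ∈ s, D i)) (p : Base g) :
    phiOf (⋃ i ∈ s, D i) hU p = ∑ i ∈ s, phiOf (D i) (hD i) p := by
  classical
  induction s using Finset.induction_on with
  | empty =>
    rw [Finset.sum_empty, phiOf_eq_coe_FVOf, FVOf]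
    have : chiOf (⋃ i ∈ (∅ : Finset ι), D i) p = 0 := by
      by_cases h : p ∈ coverU g ∩ coverV g
      · rw [chiOf_of_mem h]; simp
      · exact chiOf_of_not_mem h
    rw [this, mul_zero]; rfl
  | insert a s ha ih =>
    have hs : IsClopen (⋃ i ∈ s, D i) := by
      have : (⋃ i ∈ s, D i) = ⋃ i ∈ (s : Set ι), D i := rfl
      exact s.finite_toSet.isClopen_biUnion fun i _ => hD i
    have hdisj : Disjoint (D a) (⋃ i ∈ s, D i) := by
      rw [disjoint_iUnion₂_right]
      intro i hi
      exact hd (fun h => ha (h ▸ hi))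
    have e : (⋃ i ∈ insert a s, D i) = D a ∪ ⋃ i ∈ s, D i := Finset.set_biUnion_insert a s D
    have key : phiOf (⋃ i ∈ insert a s, D i) hU p = phiOf (D a ∪ ⋃ i ∈ s, D i) ((hD a).union hs) p := by
      simp only [phiOf_eq_coe_FVOf, FVOf, e]
    rw [key, phiOf_union (hD a) hs hdisj, Finset.sum_insert ha, ih hs]

/-- `χ_{U ∩ V} = 1` on `U ∩ V`. [folklore] -/
theorem chiOf_univ {p : Base g} (h : p ∈ coverU g ∩ coverV g) : chiOf (univ : Set ↥(coverU g ∩ coverV g)) p = 1 :=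
  chiOf_eq_one h (mem_univ _)

/-- **The map of `C = U ∩ V` is `ρ_V mod 1`**, which has the global real lift `ρ_V`: on `U ∩ V`,
`FVOf = ρ_V − 1 ≡ ρ_V`; on `U ∖ V`, `FVOf = 0 = ρ_V`; on `V ∖ U`, `FVOf = 0 ≡ 1 = ρ_V`.
[cite: BottTu1982Forms, §2 Ex. 2.5] -/
theorem phiOf_univ (p : Base g) :
    phiOf (univ : Set ↥(coverU g ∩ coverV g)) isClopen_univ p = ((rhoV p : ℝ) : UnitAddCircle) := by
  rw [phiOf_eq_coe_FVOf, FVOf]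
  by_cases h : p ∈ coverU g ∩ coverV g
  · rw [chiOf_univ h, mul_one]
    have : rhoV p - 1 = rhoV p + ((-1 : ℤ) : ℝ) := by push_cast; ring
    rw [this, coe_add_intCast]
  · rw [chiOf_of_not_mem h, mul_zero]
    have hcov : p ∈ coverU g ∪ coverV g := by rw [coverU_union_coverV]; exact mem_univ p
    rcases hcov with hU | hV
    · have hV : p ∉ coverV g := fun hV => h ⟨hU, hV⟩
      rw [mem_coverV_iff, not_lt] at hV
      rw [rhoV_eq_zero (by linarith)]
    · have hU : p ∉ coverU g := fun hU => h ⟨hU, hV⟩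
      rw [mem_coverU_iff, not_lt] at hU
      rw [rhoV_eq_one (by linarith)]
      have : ((1 : ℝ) : UnitAddCircle) = (((0 : ℝ) + ((1 : ℤ) : ℝ) : ℝ) : UnitAddCircle) := by
        push_cast; ring_nf
      rw [this, coe_add_intCast]

/-! ### Equivariance under symmetries preserving `Re x^{2g+1}` -/

section Symmetry

variable (T : C(Base g, Base g)) (hT : ∀ p, rePow (T p) = rePow p)
include hT

/-- A symmetry preserving `Re x^{2g+1}` preserves `U`. [folklore] -/
theorem mem_coverU_symm (p : Base g) : T p ∈ coverU g ↔ p ∈ coverU g := by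
  rw [mem_coverU_iff, mem_coverU_iff, hT]

/-- A symmetry preserving `Re x^{2g+1}` preserves `V`. [folklore] -/
theorem mem_coverV_symm (p : Base g) : T p ∈ coverV g ↔ p ∈ coverV g := by
  rw [mem_coverV_iff, mem_coverV_iff, hT]

/-- A symmetry preserving `Re x^{2g+1}` preserves `U ∩ V`. [folklore] -/
theorem mem_inter_symm (p : Base g) : T p ∈ coverU g ∩ coverV g ↔ p ∈ coverU g ∩ coverV g := by
  rw [mem_inter_iff, mem_inter_iff, mem_coverU_symm T hT, mem_coverV_symm T hT]

/-- A symmetry preserving `Re x^{2g+1}` preserves `ρ_V`. [folklore] -/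
theorem rhoV_symm (p : Base g) : rhoV (T p) = rhoV p := by
  rw [rhoV, rhoV, hT]

/-- The restriction of the symmetry to `U ∩ V`. [folklore] -/
def restrictSymm : C(↥(coverU g ∩ coverV g), ↥(coverU g ∩ coverV g)) :=
  ⟨fun q => ⟨T q.1, (mem_inter_symm T hT q.1).2 q.2⟩,
    (T.continuous.comp continuous_subtype_val).subtype_mk _⟩

/-- Unfolding the restricted symmetry. [folklore] -/
@[simp] theorem restrictSymm_apply_coe (q : ↥(coverU g ∩ coverV g)) :
    ((restrictSymm T hT q : ↥(coverU g ∩ coverV g)) : Base g) = T q.1 :=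
  rfl

/-- **The pulled-back clopen set `T⁻¹ C ⊆ U ∩ V`.** [folklore] -/
def preimSymm (C : Set ↥(coverU g ∩ coverV g)) : Set ↥(coverU g ∩ coverV g) :=
  restrictSymm T hT ⁻¹' C

/-- Membership in `T⁻¹ C`. [folklore] -/
theorem mem_preimSymm_iff (C : Set ↥(coverU g ∩ coverV g)) (q : ↥(coverU g ∩ coverV g)) :
    q ∈ preimSymm T hT C ↔ (⟨T q.1, (mem_inter_symm T hT q.1).2 q.2⟩ : ↥(coverU g ∩ coverV g)) ∈ C :=
  Iff.rfl

/-- `T⁻¹ C` is clopen if `C` is. [folklore] -/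
theorem isClopen_preimSymm (hC : IsClopen C) : IsClopen (preimSymm T hT C) :=
  hC.preimage (restrictSymm T hT).continuous

/-- `T⁻¹` preserves disjointness. [folklore] -/
theorem disjoint_preimSymm (hd : Disjoint C C') : Disjoint (preimSymm T hT C) (preimSymm T hT C') :=
  hd.preimage _

/-- `χ_C ∘ T = χ_{T⁻¹ C}`. [folklore] -/
theorem chiOf_symm (C : Set ↥(coverU g ∩ coverV g)) (p : Base g) :
    chiOf C (T p) = chiOf (preimSymm T hT C) p := by
  by_cases h : p ∈ coverU g ∩ coverV g
  · have hT' : T p ∈ coverU g ∩ coverV g := (mem_inter_symm T hT p).2 h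
    by_cases hC : (⟨T p, hT'⟩ : ↥(coverU g ∩ coverV g)) ∈ C
    · rw [chiOf_eq_one hT' hC, chiOf_eq_one h ((mem_preimSymm_iff T hT C ⟨p, h⟩).2 hC)]
    · rw [chiOf_eq_zero hT' hC, chiOf_eq_zero h (fun h' => hC ((mem_preimSymm_iff T hT C ⟨p, h⟩).1 h'))]
  · rw [chiOf_of_not_mem h, chiOf_of_not_mem (fun h' => h ((mem_inter_symm T hT p).1 h'))]

/-- `FVOf C ∘ T = FVOf (T⁻¹ C)`. [folklore] -/
theorem FVOf_symm (C : Set ↥(coverU g ∩ coverV g)) (p : Base g) :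
    FVOf C (T p) = FVOf (preimSymm T hT C) p := by
  rw [FVOf, FVOf, rhoV_symm T hT, chiOf_symm T hT]

/-- `FUOf C ∘ T = FUOf (T⁻¹ C)`. [folklore] -/
theorem FUOf_symm (C : Set ↥(coverU g ∩ coverV g)) (p : Base g) :
    FUOf C (T p) = FUOf (preimSymm T hT C) p := by
  rw [FUOf, FUOf, rhoV_symm T hT, chiOf_symm T hT]

/-- **Equivariance: `phiOf C ∘ T = phiOf (T⁻¹ C)`** for a symmetry `T` preserving `Re x^{2g+1}`.
[cite: BottTu1982Forms, §2 Prop. 2.3] -/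
theorem phiOf_symm (hC : IsClopen C) (p : Base g) :
    phiOf C hC (T p) = phiOf (preimSymm T hT C) (isClopen_preimSymm T hT hC) p := by
  rw [phiOf_eq_coe_FVOf, phiOf_eq_coe_FVOf, FVOf_symm T hT]

end Symmetry

end LefschetzBase

end Literature.Topology.FourManifolds
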